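import Literature.MathematicalPhysics.QuantumFieldTheory.BalabanImbrieJaffe1984to88.BIJ88TaylorSplit5614
import Literature.MathematicalPhysics.QuantumFieldTheory.BalabanImbrieJaffe1984to88.BIJ88ChargePowerLogScale

/-!
# `BalabanImbrieJaffe1984to88.BIJ88Eq5613Summary` — T. Bałaban, J. Imbrie, A. Jaffe, *Effective action and cluster properties of the
abelian Higgs model*, Commun. Math. Phys. **114** (1988) 257–315 [BalabanImbrieJaffe1988], §5.6 *Expansion with Respect to the
Fluctuation Field*, p. 288 [PDF 32]: the SUMMARY identity **(5.6.13)** of the fluctuation-field expansion of the action, as an exact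
identity of `e′`-family data with the remainder `Σ_□ W₁^{(k)}(□)` made of its four printed sources, the cube bookkeeping, the bound
shape, and the `e_k`-arithmetic behind *"|W₁^{(k)}(□)| ≦ e_k^{n̄−1−α}"*

statement-level skeleton of published theorems with citation tags; proofs where landed; nothing here is a claim about the Yang–Mills mass gap

PDF held: `paper:balaban1988-cmp114-bij-abelian-higgs-effective-action` (journal page = PDF page + 256); p. 288 [PDF 32] read as an
image this session (r16's render `HOME/lit-balaban-r16/renders/cmp114/original-p032-x2.png`), p. 287 [PDF 31], pp. 262–265 [PDF 6–9]
and pp. 278–279 [PDF 22–23] likewise (seat renders).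

CITATION HEADER (lean-in-tree rule).  Part of the lit-balaban TYPED SKELETON (HOME `run/shared/lean/pub/lit-balaban/`), PHASE-2 proof
seat p31 gen 11 (unit `lit-balaban-p31-g11`; TAKING line HOME/STATUS.md 2026-08-22T02:59Z).  WHAT IS REPRODUCED: row `C2.Eq5.6.13` of
`HOME/lit-balaban-r16/ROWS-C2-part2.md` (owner r16; status before this file: *"typed p240155 (bound clause as Prop leaf); the
expansion identity (5.6.13) absent"*), p. 288 [PDF 32], verbatim:

*"We expand the phase factors as 1 + (e^{ie_kw₂A′} − 1), the second term being extremely small. We also have the field strength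
expanded as f′_k = f̃^η_{k+1} + ∂w₁A′ + ∂(θ_kH_{k,loc}A^{(k)}). Any term involving w₁ or w₂, and terms of higher than n̄-th order in e_k
are irrelevant and will be treated separately. The lower order terms are polynomials in A^{(k)}. All terms are local. Let us
summarize these expansions as follows. In the action we have written
½aL⁻²⟨ψ̃ − Q(u′_k)φ̃, ψ̃ − Q(u′_k)φ̃⟩ + ½⟨Λ₈^{(k−1)′}φ̃, Δ_{k,loc}(u′_k)Λ₈^{(k−1)′}φ̃⟩ + 𝒫_{k,loc}(Λ₈^{(k−1)}φ̃, u′_k)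
 = ½aL⁻²⟨ψ − Q(ũ_{k+1})φ, ψ − Q(ũ_{k+1})φ⟩ + ½⟨Λ₈^{(k−1)′}φ, Δ_{k,loc}(ũ_{k+1})Λ₈^{(k−1)′}φ⟩ + 𝒫_{k,loc}(Λ₈^{(k−1)}, φ, ũ_{k+1})
 + R^{(k)}(u_{k+1}, θ_kH_{k,loc}A^{(k)}) + Σ_□ W₁^{(k)}(□). (5.6.13)
The tildes on φ and ψ indicate the presence of the phase factors. Here W₁^{(k)}(□) is localized near □, an r(e_k)-cube in Λ₂^{(k)},
and |W₁^{(k)}(□)| ≦ e_k^{n̄−1−α}. (Two powers of e_k may be needed to beat the bounds on φ.) If we define R̃^{(k)}(ũ_{k+1},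
θ_kH_{k,loc}A^{(k)}) = Σ_{n=1}^{n̄} [dⁿ/de′ⁿ(…)]_{e′=0}, (5.6.14) then R^{(k)} can be obtained by replacing propagators G_k(□, ũ_{k+1}) with
G_{k,loc}(ũ_{k+1}) and eliminating extra kernels ζ″_k explicitly (not in G_{k,loc}(ũ_{k+1}))."*

THE READING (declared; the paper displays no formula for `W₁^{(k)}(□)`).  Write `𝒮(u; φ, ψ)` for the three-term action functional
of (5.6.13) (values in a real normed space `E`; print: `E = ℝ`).  The left side is `S_phys := 𝒮(ũ_{k+1}ũ; φ̃, ψ̃)` — the action at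
the translated field `u′_k = ũ_{k+1}ũ` of (5.6.6), `ũ = exp ie_kη[θ_kH_{k,loc}A^{(k)} + w₁A′]`, with the phase factors `e^{ie_kw₂A′}` on
the scalar fields.  Along the interpolation of (5.6.14), `F(e′) := 𝒮(ũ_{k+1}e^{ie′e_kηθ_kH_{k,loc}A^{(k)}}; φ, ψ)` (p02's `e′`-families,
`BIJ88TaylorSplit5614`), `F(0)` is the sum of the three main terms of the right side and `R̃^{(k)} = Rtilde F n̄` (the Taylor terms of
orders `1 … n̄`, weights `1/n!` — reading (i) of p02, GAPS G-C2-11, owner-concurred).  With `S_w := 𝒮(ũ_{k+1}ũ; φ, ψ)` (no phase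
factors) and `δR := R̃^{(k)} − R^{(k)}` (the localization *"replacing propagators G_k(□, ũ_{k+1}) with G_{k,loc}(ũ_{k+1}) and
eliminating extra kernels ζ″_k"*, a datum here), (5.6.13) DEFINES
  `Σ_□ W₁^{(k)}(□) := S_phys − F(0) − R^{(k)}`                                                            (`W1`, `eq5613`)
and the four printed sources of `W₁` are the four summands of the exact decomposition
  `W₁ = (S_phys − S_w) + (S_w − F(1)) + F̃ + δR`                                                          (`W1_eq_sources`):
the phase factors (*"the second term being extremely small"*), the `w₁` terms (*"Any term involving w₁ or w₂ … treated
separately"*), the Taylor remainder `F̃ = F(1) − F(0) − R̃^{(k)}` of order `> n̄` (*"terms of higher than n̄-th order in e_k are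
irrelevant"*; p02's `Ftilde`/`split_S`), and the localization `δR`.  Site by site the same bookkeeping holds for the site
densities of the three (local) terms, and `W₁^{(k)}(□) := Σ_{y ∈ □}(site terms)` (`cubeSum`) is the cube decomposition (*"All terms
are local"*, *"W₁^{(k)}(□) is localized near □"*).

WHAT IS PROVED (0 `sorry`, standard axioms; two bookkeeping `def`s with bodies + theorems, no `Prop` facts).
* §1 kernel lemmas over p02's Taylor data for GLOBALLY smooth families (`iteratedDerivWithin` on `[0,1]` = `iteratedDeriv`):
  `split` (`F 1 = F 0 + R̃ + F̃`, pure algebra), `iteratedDerivWithin_uIcc_eq`, `Rtilde_eq_sum_iteratedDeriv`, `Rtilde_sum`/`Ftilde_sum`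
  (additivity over finite sums of smooth families — the site/cube bookkeeping), `Rtilde_const`/`Ftilde_const`,
  `norm_Ftilde_le_of_contDiff` (`‖F̃‖ ≤ C/n̄!` from a bound `C` on `dⁿ̄⁺¹F/de′ⁿ̄⁺¹` on `[0,1]`).
* §2 **(5.6.13)**: `W1`, **`eq5613`** (the display, exact), **`W1_eq_sources`** (the four sources), `norm_W1_le` (triangle inequality),
  **`norm_W1_le_of_deriv`** (`‖W₁‖ ≤ ε_phase + ε_{w₁} + C/n̄! + δ`).
* §3 cubes: `cubeSum`, `sum_eq_sum_cubeSum` (`Σ_y = Σ_□ Σ_{y∈□}`), **`eq5613_sites`** ((5.6.13) summed over sites with `Σ_□ W₁(□)` on the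
  right), `W1_sum` (the total `W₁` of the summed families IS the sum of the site `W₁`'s), `cubeSum_congr` (locality),
  `norm_cubeSum_le` (`|□|`-many sites),
  **`ineq5613_of_cube_bounds`** (per-cube bounds ⇒ r16's row leaf `BIJ88Sect5StatementsPart2.Ineq5613` for `W₁ = cubeSum …`).
* §4 the `e_k`-arithmetic of *"|W₁^{(k)}(□)| ≦ e_k^{n̄−1−α} (Two powers of e_k may be needed to beat the bounds on φ.)"*: a bound of the
  shape `K·e_k^{m}·(log e_k⁻¹)^q` (the `n̄+1` powers of `e_k` from the `e′`-derivatives times the field bounds `O(p(e_k)/e_k)` twice,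
  times `|□| ≤ r(e_k)^d` sites, all logarithms (2.3)/(2.33) collected in `q`) is `≤ e_k^{m−α}` once `e_k ≤ threshold K q α`
  (**`absorb_logs`**, explicit threshold, via p02 g7's `BIJ88ChargePowerLogScale`); `pLog_eq_rpow`/`rLen_eq_rpow`/`one_le_log_inv`/
  `log_rpow_le_log_rpow`/`log_rpow_mul_log_rpow`/`log_rpow_pow` (bookkeeping of the logarithmic scales; `0 ≤ log e⁻¹`, `p(e) ≥ 0`,
  `r(e) ≥ 0` are the tree's `Balaban1983to89.B10.log_inv_nonneg_of_le_one`, `BIJ88RestrictionsVanish308.pLog_nonneg`,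
  `BIJ88CurlyDkLocTorus.rLen_nonneg`, inlined here rather than imported); **`exp_neg_mul_rLen_le_rpow`** (the *"extremely
  small"* sources: `e^{−c r(e_k)} ≤ e_k^N` as soon as `(log e_k⁻¹)^{r−1} ≥ N/c`, `r > 1` as in (2.3)).
MODEL INSTANCE.  The companion file `BIJ88Eq5613Kinetic` (same seat) instantiates §§1–4 for the kinetic term
`½aL⁻²‖ψ − Q(ũ_{k+1}e^{ie′B})φ‖²` at operator level on r16's `covAvg` and proves `|W₁,kin(□)| ≤ e_k^{n̄−1−α}` there under displayed
small-field hypotheses.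
HONEST SCOPE.  Nothing here constructs `𝒮`: the `Δ_{k,loc}` term ((2.34), r18) and `𝒫_{k,loc}` (p. 275: *"given by a perturbation
expansion up to some fixed order n̄, which we describe in detail in a later paper"*) enter as `e′`-families with displayed
derivative bounds; the smallness of the phase-factor and `w₁` sources is (5.4.7) (row C2.Eq5.4.7) and is displayed, not derived; the
localization `δR` is a datum.  Imports p02's `BIJ88TaylorSplit5614` and `BIJ88ChargePowerLogScale`; no Summits import; modifies
nothing.  Unit `lit-balaban-p31` (literature-prover-lit-balaban-p31-g11-0), 2026-08-22.  NOT summit progress; NOT continuum; NOT Clay.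
-/

noncomputable section

open scoped BigOperators
open Set

namespace Literature.MathematicalPhysics.QuantumFieldTheory.BalabanImbrieJaffe1984to88.BIJ88Eq5613Summary

open BIJ88TaylorSplit5614 (Rtilde Fmbar Ftilde eq5614 Fmbar_eq_add_Rtilde Fmbar_eq_taylorWithinEval)
open BIJ88Sect5StatementsPart2 (Ineq5613)
open BIJ88Sect2Statements (pLog rLen)

variable {E : Type*} [NormedAddCommGroup E] [NormedSpace ℝ E]

/-! ## §1 Taylor data of globally smooth `e′`-families -/

section Taylor

/-- kernel: the order bookkeeping `F(1) = F(0) + R̃ + F̃` of (5.6.13)/(5.6.14) — pure algebra on p02's definitions (`F̃ := F(1) −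
F^{(n̄)}`, `F^{(n̄)} = F(0) + R̃`), no smoothness needed. [cite: BalabanImbrieJaffe1988, (5.6.13) p.288] -/
theorem split (F : ℝ → E) (nbar : ℕ) : F 1 = F 0 + Rtilde F nbar + Ftilde F nbar := by
  rw [eq5614 F nbar, Fmbar_eq_add_Rtilde]

/-- kernel: on `[0,1]` the one-sided iterated derivative of a globally `Cⁿ` family is the ordinary one.
[cite: BalabanImbrieJaffe1988, (5.6.14) p.288] -/
theorem iteratedDerivWithin_uIcc_eq {F : ℝ → E} {n : ℕ} (hF : ContDiff ℝ n F) {t : ℝ} (ht : t ∈ Set.uIcc (0 : ℝ) 1) :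
    iteratedDerivWithin n F (Set.uIcc 0 1) t = iteratedDeriv n F t := by
  rw [Set.uIcc_of_le zero_le_one] at ht ⊢
  exact iteratedDerivWithin_eq_iteratedDeriv (uniqueDiffOn_Icc zero_lt_one) hF.contDiffAt ht

/-- kernel: for a smooth family `R̃ = Σ_{n=1}^{n̄} (1/n!)·dⁿF/de′ⁿ(0)` with ORDINARY derivatives ((5.6.14)₁ for smooth `𝒮`).
[cite: BalabanImbrieJaffe1988, (5.6.14) p.288] -/
theorem Rtilde_eq_sum_iteratedDeriv {F : ℝ → E} (hF : ∀ n : ℕ, ContDiff ℝ n F) (nbar : ℕ) :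
    Rtilde F nbar = ∑ n ∈ Finset.range nbar, ((1 : ℝ) / (n + 1).factorial) • iteratedDeriv (n + 1) F 0 := by
  unfold Rtilde
  refine Finset.sum_congr rfl fun n _ => ?_
  rw [iteratedDerivWithin_uIcc_eq (hF (n + 1)) (by simp)]

/-- kernel: `R̃` is additive over finite sums of smooth families — the site/cube bookkeeping of (5.6.13) (*"All terms are local"*).
[cite: BalabanImbrieJaffe1988, (5.6.13) p.288] -/
theorem Rtilde_sum {ι : Type*} (s : Finset ι) {F : ι → ℝ → E} (hF : ∀ i ∈ s, ∀ n : ℕ, ContDiff ℝ n (F i)) (nbar : ℕ) :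
    Rtilde (fun t => ∑ i ∈ s, F i t) nbar = ∑ i ∈ s, Rtilde (F i) nbar := by
  unfold Rtilde
  rw [Finset.sum_comm]
  refine Finset.sum_congr rfl fun n _ => ?_
  rw [iteratedDerivWithin_fun_sum (by simp) (by rw [Set.uIcc_of_le zero_le_one]; exact uniqueDiffOn_Icc zero_lt_one)
    fun i hi => ((hF i hi (n + 1)).contDiffAt (x := (0 : ℝ))).contDiffWithinAt, Finset.smul_sum]

/-- kernel: `F̃` is additive over finite sums of families (pure algebra given `R̃`'s additivity).
[cite: BalabanImbrieJaffe1988, (5.6.13) p.288] -/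
theorem Ftilde_sum {ι : Type*} (s : Finset ι) {F : ι → ℝ → E} (hF : ∀ i ∈ s, ∀ n : ℕ, ContDiff ℝ n (F i)) (nbar : ℕ) :
    Ftilde (fun t => ∑ i ∈ s, F i t) nbar = ∑ i ∈ s, Ftilde (F i) nbar := by
  have h1 := split (fun t => ∑ i ∈ s, F i t) nbar
  rw [Rtilde_sum s hF] at h1
  have h2 : ∀ i ∈ s, Ftilde (F i) nbar = F i 1 - F i 0 - Rtilde (F i) nbar := fun i _ => by
    have := split (F i) nbar
    rw [this]; abel
  rw [Finset.sum_congr rfl h2, Finset.sum_sub_distrib, Finset.sum_sub_distrib, h1]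
  abel

/-- kernel: a constant family has `R̃ = 0`. [cite: BalabanImbrieJaffe1988, (5.6.14) p.288] -/
theorem Rtilde_const (c : E) (nbar : ℕ) : Rtilde (fun _ : ℝ => c) nbar = 0 := by
  unfold Rtilde
  refine Finset.sum_eq_zero fun n _ => ?_
  rw [iteratedDerivWithin_uIcc_eq (contDiff_const (c := c)) (by simp), iteratedDeriv_const]
  simp

/-- kernel: a constant family has `F̃ = 0`. [cite: BalabanImbrieJaffe1988, (5.6.14) p.288] -/
theorem Ftilde_const (c : E) (nbar : ℕ) : Ftilde (fun _ : ℝ => c) nbar = 0 := by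
  have h := split (fun _ : ℝ => c) nbar
  rw [Rtilde_const, add_zero] at h
  exact left_eq_add.mp h

/-- kernel: the SHAPE of the Taylor-remainder source for a globally smooth family — a bound `C` on the `(n̄+1)`-st ordinary
derivative on `[0,1]` gives `‖F̃‖ ≤ C/n̄!` (p02's `norm_Ftilde_le` with `iteratedDerivWithin` discharged).
[cite: BalabanImbrieJaffe1988, (5.6.13) p.288] -/
theorem norm_Ftilde_le_of_contDiff [CompleteSpace E] {F : ℝ → E} {nbar : ℕ} {C : ℝ} (hF : ∀ n : ℕ, ContDiff ℝ n F)
    (hC : ∀ t ∈ Set.Icc (0 : ℝ) 1, ‖iteratedDeriv (nbar + 1) F t‖ ≤ C) :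
    ‖Ftilde F nbar‖ ≤ C / nbar.factorial := by
  refine BIJ88TaylorSplit5614.norm_Ftilde_le (hF (nbar + 1)).contDiffOn fun t ht => ?_
  rw [iteratedDerivWithin_uIcc_eq (hF (nbar + 1)) ht]
  rw [Set.uIcc_of_le zero_le_one] at ht
  exact hC t ht

end Taylor

/-! ## §2 (5.6.13): the identity and the four sources of `W₁` -/

section Identity

/-- **`Σ_□ W₁^{(k)}(□)` of (5.6.13)**, DEFINED by the display: `W₁ := S_phys − F(0) − R^{(k)}` with `R^{(k)} = R̃^{(k)} − δR`
(`S_phys` = the left side, the action at `u′_k = ũ_{k+1}ũ` with the phase factors; `F` = the `e′`-family of (5.6.14) so that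
`F 0` = the three main terms at `ũ_{k+1}` and `R̃^{(k)} = Rtilde F n̄`; `δR` = the localization `R̃^{(k)} − R^{(k)}`; the action `S_w`
at `ũ_{k+1}ũ` WITHOUT the phase factors only enters the decomposition `W1_eq_sources`). [cite: BalabanImbrieJaffe1988, (5.6.13) p.288] -/
def W1 (Sphys : E) (F : ℝ → E) (nbar : ℕ) (δR : E) : E :=
  Sphys - F 0 - (Rtilde F nbar - δR)

/-- **(5.6.13)** p. 288 [PDF 32], verbatim: *"[left side] = [the three main terms at ũ_{k+1}] + R^{(k)}(u_{k+1}, θ_kH_{k,loc}A^{(k)}) +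
Σ_□ W₁^{(k)}(□). (5.6.13)"* — exact, with `R^{(k)} = R̃^{(k)} − δR` and `W₁` as defined. [cite: BalabanImbrieJaffe1988, (5.6.13) p.288] -/
theorem eq5613 (Sphys : E) (F : ℝ → E) (nbar : ℕ) (δR : E) :
    Sphys = F 0 + (Rtilde F nbar - δR) + W1 Sphys F nbar δR := by
  unfold W1; abel

/-- **The four printed sources of `W₁`**: `W₁ = (S_phys − S_w) + (S_w − F(1)) + F̃ + δR` — the phase factors (*"We expand the phase
factors as 1 + (e^{ie_kw₂A′} − 1), the second term being extremely small"*), the `w₁` terms (*"Any term involving w₁ or w₂ … will be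
treated separately"*), the order-`> n̄` Taylor remainder `F̃ = F(1) − F(0) − R̃^{(k)}` (*"terms of higher than n̄-th order in e_k are
irrelevant"*), and the localization `δR = R̃^{(k)} − R^{(k)}`. [cite: BalabanImbrieJaffe1988, (5.6.13) p.288] -/
theorem W1_eq_sources (Sphys Sw : E) (F : ℝ → E) (nbar : ℕ) (δR : E) :
    W1 Sphys F nbar δR = (Sphys - Sw) + (Sw - F 1) + Ftilde F nbar + δR := by
  have h := split F nbar
  have hF : Ftilde F nbar = F 1 - F 0 - Rtilde F nbar := by rw [h]; abel
  rw [hF, W1]; abel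

/-- kernel: `‖W₁‖ ≤ ‖S_phys − S_w‖ + ‖S_w − F(1)‖ + ‖F̃‖ + ‖δR‖`. [cite: BalabanImbrieJaffe1988, (5.6.13) p.288] -/
theorem norm_W1_le (Sphys Sw : E) (F : ℝ → E) (nbar : ℕ) (δR : E) :
    ‖W1 Sphys F nbar δR‖ ≤ ‖Sphys - Sw‖ + ‖Sw - F 1‖ + ‖Ftilde F nbar‖ + ‖δR‖ := by
  rw [W1_eq_sources Sphys Sw]
  exact (norm_add_le _ _).trans (add_le_add ((norm_add_le _ _).trans (add_le_add (norm_add_le _ _) le_rfl)) le_rfl)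

/-- **The bound shape of `W₁`**: smallness `ε_φ` of the phase-factor source, `ε_w` of the `w₁` source, a bound `C` on the `(n̄+1)`-st
`e′`-derivative of the (smooth) family on `[0,1]`, and `δ` on the localization give `‖W₁‖ ≤ ε_φ + ε_w + C/n̄! + δ`.
[cite: BalabanImbrieJaffe1988, (5.6.13) p.288] -/
theorem norm_W1_le_of_deriv [CompleteSpace E] {Sphys Sw : E} {F : ℝ → E} {nbar : ℕ} {δR : E} {εφ εw C δ : ℝ}
    (hF : ∀ n : ℕ, ContDiff ℝ n F) (hC : ∀ t ∈ Set.Icc (0 : ℝ) 1, ‖iteratedDeriv (nbar + 1) F t‖ ≤ C)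
    (hφ : ‖Sphys - Sw‖ ≤ εφ) (hw : ‖Sw - F 1‖ ≤ εw) (hδ : ‖δR‖ ≤ δ) :
    ‖W1 Sphys F nbar δR‖ ≤ εφ + εw + C / nbar.factorial + δ :=
  (norm_W1_le Sphys Sw F nbar δR).trans (by gcongr; exact norm_Ftilde_le_of_contDiff hF hC)

end Identity

/-! ## §3 Cubes: `W₁^{(k)}(□) = Σ_{y ∈ □}` and the row leaf `Ineq5613` -/

section Cubes

variable {σ γ : Type*} [DecidableEq γ]

/-- **`W₁^{(k)}(□)`**: the sum of site terms over the sites of the cube `□` — `cubeSum Y cube f □ = Σ_{y ∈ Y, cube y = □} f y` for a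
cube assignment `cube : σ → γ` of the sites (*"W₁^{(k)}(□) is localized near □, an r(e_k)-cube in Λ₂^{(k)}"*).
[cite: BalabanImbrieJaffe1988, (5.6.13) p.288] -/
def cubeSum {M : Type*} [AddCommMonoid M] (Y : Finset σ) (cube : σ → γ) (f : σ → M) (c : γ) : M :=
  ∑ y ∈ Y.filter (fun y => cube y = c), f y

/-- kernel: `Σ_{y ∈ Y} f y = Σ_□ W(□)` over the cubes met by `Y`. [cite: BalabanImbrieJaffe1988, (5.6.13) p.288] -/
theorem sum_eq_sum_cubeSum {M : Type*} [AddCommMonoid M] (Y : Finset σ) (cube : σ → γ) (f : σ → M) :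
    ∑ y ∈ Y, f y = ∑ c ∈ Y.image cube, cubeSum Y cube f c := by
  unfold cubeSum
  exact (Finset.sum_fiberwise_of_maps_to (fun y hy => Finset.mem_image_of_mem cube hy) f).symm

/-- kernel: a cube not met by `Y` carries `W(□) = 0`. [cite: BalabanImbrieJaffe1988, (5.6.13) p.288] -/
theorem cubeSum_eq_zero_of_not_mem {M : Type*} [AddCommMonoid M] (Y : Finset σ) (cube : σ → γ) (f : σ → M) {c : γ}
    (hc : c ∉ Y.image cube) : cubeSum Y cube f c = 0 := by
  unfold cubeSum
  refine Finset.sum_eq_zero fun y hy => ?_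
  rw [Finset.mem_filter] at hy
  exact absurd (hy.2 ▸ Finset.mem_image_of_mem cube hy.1) hc

/-- kernel (*"W₁^{(k)}(□) is localized near □"*): `W(□)` depends only on the site terms of the sites of `□`.
[cite: BalabanImbrieJaffe1988, (5.6.13) p.288] -/
theorem cubeSum_congr {M : Type*} [AddCommMonoid M] (Y : Finset σ) (cube : σ → γ) {f g : σ → M} {c : γ}
    (h : ∀ y ∈ Y, cube y = c → f y = g y) : cubeSum Y cube f c = cubeSum Y cube g c := by
  unfold cubeSum
  refine Finset.sum_congr rfl fun y hy => ?_
  rw [Finset.mem_filter] at hy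
  exact h y hy.1 hy.2

omit [NormedSpace ℝ E] in
/-- kernel: `|□|`-many sites, each bounded by `b`, give `‖W(□)‖ ≤ |□|·b`. [cite: BalabanImbrieJaffe1988, (5.6.13) p.288] -/
theorem norm_cubeSum_le (Y : Finset σ) (cube : σ → γ) (f : σ → E) (c : γ) {b : ℝ}
    (hb : ∀ y ∈ Y, cube y = c → ‖f y‖ ≤ b) :
    ‖cubeSum Y cube f c‖ ≤ (Y.filter (fun y => cube y = c)).card * b := by
  unfold cubeSum
  refine (norm_sum_le _ _).trans ?_
  have h : ∀ y ∈ Y.filter (fun y => cube y = c), ‖f y‖ ≤ b := fun y hy => by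
    rw [Finset.mem_filter] at hy
    exact hb y hy.1 hy.2
  refine (Finset.sum_le_sum h).trans ?_
  rw [Finset.sum_const, nsmul_eq_mul]

/-- **(5.6.13) summed over sites**: if at every site `y` the site densities obey the bookkeeping of §2 (`S_phys(y)`, `S_w(y)`, the
site family `F_y`, `δR(y)`), then `Σ_y S_phys(y) = Σ_y F_y(0) + Σ_y R^{(k)}(y) + Σ_□ W₁^{(k)}(□)` with
`W₁^{(k)}(□) = Σ_{y∈□} W₁(y)` — the display with its last term a sum over cubes. [cite: BalabanImbrieJaffe1988, (5.6.13) p.288] -/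
theorem eq5613_sites (Y : Finset σ) (cube : σ → γ) (Sphys : σ → E) (F : σ → ℝ → E) (nbar : ℕ) (δR : σ → E) :
    ∑ y ∈ Y, Sphys y = ∑ y ∈ Y, F y 0 + ∑ y ∈ Y, (Rtilde (F y) nbar - δR y)
      + ∑ c ∈ Y.image cube, cubeSum Y cube (fun y => W1 (Sphys y) (F y) nbar (δR y)) c := by
  rw [← sum_eq_sum_cubeSum, ← Finset.sum_add_distrib, ← Finset.sum_add_distrib]
  exact Finset.sum_congr rfl fun y _ => eq5613 (Sphys y) (F y) nbar (δR y)

/-- kernel: the TOTAL `W₁` of the summed data (total action, total family `Σ_y F_y`, total localization) IS the sum of the site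
`W₁`'s — for smooth site families (additivity of `R̃`). [cite: BalabanImbrieJaffe1988, (5.6.13) p.288] -/
theorem W1_sum (Y : Finset σ) (Sphys : σ → E) {F : σ → ℝ → E} (hF : ∀ y ∈ Y, ∀ n : ℕ, ContDiff ℝ n (F y)) (nbar : ℕ)
    (δR : σ → E) :
    W1 (∑ y ∈ Y, Sphys y) (fun t => ∑ y ∈ Y, F y t) nbar (∑ y ∈ Y, δR y)
      = ∑ y ∈ Y, W1 (Sphys y) (F y) nbar (δR y) := by
  simp only [W1, Rtilde_sum Y hF nbar, Finset.sum_sub_distrib]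

/-- **The row leaf inhabited from per-cube bounds**: if every cube term obeys `|W₁(□)| ≤ e_k^{n̄−1−α}`, r16's
`BIJ88Sect5StatementsPart2.Ineq5613` holds for `W₁ = cubeSum …` (cubes not met by the sites carry `0`).
[cite: BalabanImbrieJaffe1988, (5.6.13) p.288] -/
theorem ineq5613_of_cube_bounds {γ : Type} [DecidableEq γ] (Y : Finset σ) (cube : σ → γ) (W : σ → ℝ) {ek : ℝ} (hek : 0 < ek) (nbar : ℕ) (α : ℝ)
    (h : ∀ c ∈ Y.image cube, |cubeSum Y cube W c| ≤ ek ^ ((nbar : ℝ) - 1 - α)) :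
    Ineq5613 γ (cubeSum Y cube W) ek nbar α := by
  intro c
  by_cases hc : c ∈ Y.image cube
  · exact h c hc
  · rw [cubeSum_eq_zero_of_not_mem Y cube W hc, abs_zero]
    exact Real.rpow_nonneg hek.le _

end Cubes

/-! ## §4 The `e_k`-arithmetic of `|W₁^{(k)}(□)| ≦ e_k^{n̄−1−α}` -/

section Arithmetic

/-- kernel: `log e⁻¹ ≥ 1` for `0 < e ≤ e⁻¹` (so that powers of the logarithmic scale are monotone in the exponent).
[cite: BalabanImbrieJaffe1988, (2.33) p.263] -/
theorem one_le_log_inv {e : ℝ} (he : 0 < e) (he1 : e ≤ Real.exp (-1)) : 1 ≤ Real.log e⁻¹ := by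
  rw [Real.log_inv]
  have h := Real.log_le_log he he1
  rw [Real.log_exp] at h
  linarith

/-- kernel: `e ≤ e⁻¹` implies `e ≤ 1`. [cite: BalabanImbrieJaffe1988, (2.33) p.263] -/
theorem le_one_of_le_exp_neg_one {e : ℝ} (he1 : e ≤ Real.exp (-1)) : e ≤ 1 :=
  he1.trans (by
    have := Real.exp_le_one_iff.mpr (show (-1 : ℝ) ≤ 0 by norm_num)
    exact this)

/-- (2.33) in the regime `0 < e_k ≤ 1`: `p(e_k) = (log e_k⁻¹)^p`. [cite: BalabanImbrieJaffe1988, (2.33) p.263] -/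
theorem pLog_eq_rpow {p e : ℝ} (he : 0 < e) (he1 : e ≤ 1) : pLog p e = Real.log e⁻¹ ^ p := by
  rw [pLog, abs_of_nonneg (Real.log_nonneg (one_le_inv_iff₀.mpr ⟨he, he1⟩))]

/-- (2.3) in the regime `0 < e_k ≤ 1`: `r(e_k) = (log e_k⁻¹)^r`. [cite: BalabanImbrieJaffe1988, (2.3) p.260] -/
theorem rLen_eq_rpow {r e : ℝ} (he : 0 < e) (he1 : e ≤ 1) : rLen r e = Real.log e⁻¹ ^ r := by
  rw [rLen, abs_of_nonneg (Real.log_nonneg (one_le_inv_iff₀.mpr ⟨he, he1⟩))]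

/-- kernel: powers of the logarithmic scale are monotone in the exponent once `log e⁻¹ ≥ 1`.
[cite: BalabanImbrieJaffe1988, (2.33) p.263] -/
theorem log_rpow_le_log_rpow {e a b : ℝ} (he : 0 < e) (he1 : e ≤ Real.exp (-1)) (hab : a ≤ b) :
    Real.log e⁻¹ ^ a ≤ Real.log e⁻¹ ^ b :=
  Real.rpow_le_rpow_of_exponent_le (one_le_log_inv he he1) hab

/-- kernel: products of powers of the logarithmic scale add exponents (`log e⁻¹ ≥ 1 > 0`).
[cite: BalabanImbrieJaffe1988, (2.33) p.263] -/
theorem log_rpow_mul_log_rpow {e a b : ℝ} (he : 0 < e) (he1 : e ≤ Real.exp (-1)) :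
    Real.log e⁻¹ ^ a * Real.log e⁻¹ ^ b = Real.log e⁻¹ ^ (a + b) :=
  (Real.rpow_add (lt_of_lt_of_le one_pos (one_le_log_inv he he1)) a b).symm

/-- kernel: natural powers of the logarithmic scale: `(L^a)^n = L^{a·n}`. [cite: BalabanImbrieJaffe1988, (2.33) p.263] -/
theorem log_rpow_pow {e a : ℝ} (he : 0 < e) (he1 : e ≤ 1) (n : ℕ) :
    (Real.log e⁻¹ ^ a) ^ n = Real.log e⁻¹ ^ (a * n) := by
  rw [← Real.rpow_natCast, ← Real.rpow_mul (Real.log_nonneg (one_le_inv_iff₀.mpr ⟨he, he1⟩))]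

/-- The explicit threshold of `absorb_logs`: `e₀(K, q, α) = (2K(2q/α)^q + 1)^{−2/α}`.
[cite: BalabanImbrieJaffe1988, (5.6.13) p.288] -/
def threshold (K q α : ℝ) : ℝ := (2 * (K * (2 * q / α) ^ q) + 1) ^ (-(2 / α))

/-- kernel: the threshold is positive. [cite: BalabanImbrieJaffe1988, (5.6.13) p.288] -/
theorem threshold_pos {K q α : ℝ} (hK : 0 ≤ K) (hq : 0 ≤ q) (hα : 0 < α) : 0 < threshold K q α := by
  unfold threshold
  apply Real.rpow_pos_of_pos
  have : 0 ≤ K * (2 * q / α) ^ q := mul_nonneg hK (Real.rpow_nonneg (by positivity) _)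
  linarith

/-- **The `e_k`-arithmetic of (5.6.13)** (*"|W₁^{(k)}(□)| ≦ e_k^{n̄−1−α}. (Two powers of e_k may be needed to beat the bounds on
φ.)"*): a bound of the shape `K·e^{m}·(log e⁻¹)^q` — `m = n̄ − 1` after the two powers of `e_k` spent on the field bounds, `q`
collecting every power of the logarithmic scales `p(e_k) = (log e_k⁻¹)^p` (2.33) and `r(e_k) = (log e_k⁻¹)^r` (2.3) — is
`≤ e^{m−α}` for every `0 < e ≤ min{1, e₀(K,q,α)}`: the power `e^{α}` absorbs the logarithms (p02 g7's `rpow_mul_log_inv_rpow_le`,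
`small_of_le_threshold`). [cite: BalabanImbrieJaffe1988, (5.6.13) p.288] -/
theorem absorb_logs {K q α m e : ℝ} (hK : 0 ≤ K) (hq : 0 < q) (hα : 0 < α) (he : 0 < e) (he1 : e ≤ 1)
    (hth : e ≤ threshold K q α) :
    K * e ^ m * Real.log e⁻¹ ^ q ≤ e ^ (m - α) := by
  have hsplit : e ^ m = e ^ (m - α) * e ^ α := by
    rw [← Real.rpow_add he]; ring_nf
  have h1 : e ^ α * Real.log e⁻¹ ^ q ≤ (2 * q / α) ^ q * e ^ (α / 2) :=
    BIJ88ChargePowerLogScale.rpow_mul_log_inv_rpow_le he he1 hα hq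
  have h2 : K * (2 * q / α) ^ q * e ^ (α / 2) ≤ 1 / 2 :=
    BIJ88ChargePowerLogScale.small_of_le_threshold (mul_nonneg hK (Real.rpow_nonneg (by positivity) _)) hα he hth
  have hpos : 0 ≤ e ^ (m - α) := Real.rpow_nonneg he.le _
  calc K * e ^ m * Real.log e⁻¹ ^ q = e ^ (m - α) * (K * (e ^ α * Real.log e⁻¹ ^ q)) := by rw [hsplit]; ring
    _ ≤ e ^ (m - α) * (K * ((2 * q / α) ^ q * e ^ (α / 2))) := by gcongr
    _ = e ^ (m - α) * (K * (2 * q / α) ^ q * e ^ (α / 2)) := by ring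
    _ ≤ e ^ (m - α) * (1 / 2) := by gcongr
    _ ≤ e ^ (m - α) := by linarith

/-- `absorb_logs` in the currency of the row: `m = n̄ − 1` — a bound `K·e_k^{n̄−1}·(log e_k⁻¹)^q` is `≤ e_k^{n̄−1−α}` below the
threshold. [cite: BalabanImbrieJaffe1988, (5.6.13) p.288] -/
theorem absorb_logs_nbar {K q α e : ℝ} {nbar : ℕ} (hK : 0 ≤ K) (hq : 0 < q) (hα : 0 < α) (he : 0 < e) (he1 : e ≤ 1)
    (hth : e ≤ threshold K q α) {W : ℝ} (hW : |W| ≤ K * e ^ ((nbar : ℝ) - 1) * Real.log e⁻¹ ^ q) :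
    |W| ≤ e ^ ((nbar : ℝ) - 1 - α) :=
  hW.trans (absorb_logs hK hq hα he he1 hth)

/-- **The "extremely small" sources**: `e^{−c·r(e_k)} ≤ e_k^{N}` as soon as `(log e_k⁻¹)^{r−1} ≥ N/c` (`r(e_k) = (log e_k⁻¹)^r`,
`r > 1` as in (2.3); `c > 0`; any real `N`) — so the phase-factor and `w₁` sources, of size `O(e^{−cr(e_k)})` by (5.4.7), and the `ζ″_k`
localization are below every power of `e_k` for small `e_k`. [cite: BalabanImbrieJaffe1988, (5.6.13) p.288] -/
theorem exp_neg_mul_rLen_le_rpow {c r N e : ℝ} (hc : 0 < c) (hr : 1 < r) (he : 0 < e) (he1 : e ≤ 1)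
    (hbig : N / c ≤ Real.log e⁻¹ ^ (r - 1)) :
    Real.exp (-(c * rLen r e)) ≤ e ^ N := by
  have hL : 0 ≤ Real.log e⁻¹ := Real.log_nonneg (one_le_inv_iff₀.mpr ⟨he, he1⟩)
  rw [rLen_eq_rpow he he1, Real.rpow_def_of_pos he, Real.exp_le_exp]
  have hlog : Real.log e = -Real.log e⁻¹ := by rw [Real.log_inv, neg_neg]
  rw [hlog]
  -- goal: `-(c * L^r) ≤ -L * N`, i.e. `N * L ≤ c * L ^ r`
  have key : N * Real.log e⁻¹ ≤ c * Real.log e⁻¹ ^ r := by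
    rcases hL.eq_or_lt with hz | hpos
    · rw [← hz, mul_zero, Real.zero_rpow (by linarith : r ≠ 0), mul_zero]
    · have h1 : N ≤ c * Real.log e⁻¹ ^ (r - 1) := by
        have := mul_le_mul_of_nonneg_left hbig hc.le
        rwa [mul_div_cancel₀ _ hc.ne'] at this
      calc N * Real.log e⁻¹ ≤ c * Real.log e⁻¹ ^ (r - 1) * Real.log e⁻¹ := mul_le_mul_of_nonneg_right h1 hL
        _ = c * Real.log e⁻¹ ^ r := by
          rw [mul_assoc, ← Real.rpow_add_one hpos.ne' (r - 1)]; ring_nf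
  nlinarith [key]

end Arithmetic

end Literature.MathematicalPhysics.QuantumFieldTheory.BalabanImbrieJaffe1984to88.BIJ88Eq5613Summary

end
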